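/-
Copyright (c) 2026 the pub-hodgecm-mathlib formalisation cell (harness21).  Prover seat hodgecm-mathlib-A-p19 (g19), topic T5 = P8
«(C♯)hol interior», row «T5-B(3b) COINVARIANT JUNCTION» (desk F0P2-plan (g8), PLAN-P2 v8 §4 #3 = `F0/P2/T5b-TREE.md` §8.2), 2026-08-31.
KERNEL module: THEOREMS ONLY (no definition, no named fact, no `sorry`, no instance, no notation).  File 2∕2 of the row.
-/
import Literature.NumberTheory.Automorphic.Liu2021.ThetaLiftFromLineCoinvariantJunction
import Literature.NumberTheory.Automorphic.Liu2021.Def411WeilCarriersIrreducibleOrZeroAtLine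
import Literature.NumberTheory.Automorphic.DiscreteAutomorphicRepHasFinComponentOfIrreducible
import Literature.NumberTheory.Automorphic.DiscreteSummandProjection
import Literature.NumberTheory.Weil1964.AdelicMetaplecticFinRepReindex
import HarnessLib

/-!
# Node B of the T5 line, step (3b), file 2∕2: THE FINITE THETA INTERTWINER `θ̄_{Φ_∞} : ω(μ, ε_a, χ)_f = rhoAtLine … ιV a χ ⟶ P_f`
# and `P.HasFinComponent (rhoAtLine … ιV a χ)` for some `χ ∈ Chi`

Topic `NumberTheory/Automorphic/Liu2021`; namespace `Literature.NumberTheory.Automorphic.Liu2021`.  KERNEL: theorems only.  Cell hodgecm-mathlib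
FLOOR 0, programme P2, topic T5 = P8 «(C♯)hol interior» (`F0/P2/T5b-TREE.md` §8.2, node B «finite local–global», step (3b); file 1∕2 =
★ `ThetaLiftFromLineCoinvariantJunction`: the linearity ∕ covariance ∕ equivariance relations).

[Liu2021, proof of Prop. 4.13, Case 1, l. 2136–2137] «In other words … `π^∞ ≃ ω(μ, ε_e, χ)`» ([Rallis1984, proof of Thm. 1.2.2]: the finite component of
a global theta lift `Θ(σ)` is a quotient of the `σ_f`-coinvariants of `ω_f`).  With `Φ_∞` fixed, `Φ_f ↦ pr_P [Θ̃_{R_e E(Φ_∞ ⊗ Φ_f)}(charCM χ̃) ∘ ιA]`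
(`pr_P` = orthogonal projection onto the discrete `P ⊂ L²([U(H)])`) is linear and kills the relation module of the `χ_W`-coinvariants (file 1∕2), hence
DESCENDS to `omegaAtLine … a χ = TwistedCoinv.Coinv (finPairRepW …) (lineChar a χ.1)` — BY DEFINITION the carrier of ★ `rhoAtLine … ιV a χ`
(★ `Def411WeilCarriersAtLine`; universal property ★ `WeilCoinv.weilCoinvLift`) — as a `U(H)(𝔸_{L⁺,f})`-intertwiner into `P.finRep` for the canonical finite
transport `ιV = finPart ∘ cmAdelicFrameTransport ∘ finAdelicToAdelic` (file 1∕2 §1 + ★ `DiscreteAutomorphicRep.orthogonalProjectionOnto_rightRegular`).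
At the `χ ∈ Chi` and the pure tensor `Φ_∞ ⊗ Φ_f` of ★ (5)+(1b) it is NON-ZERO, and `rhoAtLine … ιV a χ` is irreducible-or-zero (★
`isIrreducibleOrZero_rhoVAtLine_chiSplittingLine_comp_of_surjective`, [Liu2021, Lem. D.1]; `ιV` onto by ★ `finPart_cmKTypeHom_finAdelicToAdelic_surjective`),
so it is injective (★ `hasFinComponent_of_isIrreducibleOrZero`).

* §2 (generic rank `N`) **`exists_intertwiningMap_rhoAtLine_finRep`** — the intertwiner `θ̄_{Φ_∞} : rhoAtLine … ιV a χ → P.finRep` with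
  `θ̄_{Φ_∞} (mk Φ_f) = pr_P [Θ̃_{R_e E(Φ_∞ ⊗ Φ_f)}(charCM χ̃) ∘ ιA]`.
* §3 (`N = 3`, the (C♯)hol frame) **`MeetsThetaLiftFromLine.exists_hasFinComponent_rhoAtLine_of_holCotForm`** — node B's conclusion
  `∃ χ : Chi, P.HasFinComponent (rhoAtLine … ιV a χ)` from the seam + a non-zero holomorphic-cotangent coordinate class, at the canonical `ιV`, `ιA`;
  **`…_of_coe`** — the same for ANY `ιV`, `ιA` pinned by the letter's matrix formulas `hιV`, `hιA` (they are the canonical ones, file 1∕2 §0 + ★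
  `eq_cmAdelicFrameTransport_of_coe`).

HONEST SCOPE.  Nothing of [Liu2021] is asserted; this file books nothing.  The letter ★ `meetsThetaLiftFromLine_hasFinComponent_rhoAtLine` (p826166) additionally
converts `IsHolCotangentAt` into a non-zero coordinate CLASS (continuity of cotangent forms + positivity of `μA` on opens) and supplies `CompactSpace [U(H)]` from
definiteness — both Summit-side ★ (`F0P2aCohFormsContinuous`, `F0P3HolProjectionReduction`; Literature never imports Summits), so its `_holds` closer is the
Summit-side sequel `Theorems/F0P2NodeBFinComponentHolds` over `…_of_coe`.  HC_CM is proved only modulo the printed citations until rung 0 closes.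

## References
* [Liu2021] Y. Liu, *Fourier–Jacobi cycles and arithmetic relative trace formula*, Camb. J. Math. 9 (2021) = arXiv:2102.11518, proof of
  Prop. 4.13 Case 1 (l. 2131–2137, p. 48); Def. 4.11 (l. 2090–2096); App. D §D.1 Step 3 (l. 5221), Lemma D.1 (l. 5227).
* [Rallis1984] S. Rallis, *On the Howe duality conjecture*, Compositio Math. 51 (1984), proof of Thm. 1.2.2 p. 356 (localisation of a global
  theta lift).
* [MoeglinVignerasWaldspurger1987] C. Mœglin, M.-F. Vignéras, J.-L. Waldspurger, LNM 1291 (1987), Chap. 2 II.2, Chap. 3 IV (maximal isotypic quotients).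
* [BorelJacquet1979] A. Borel, H. Jacquet, PSPM 33.1 (1979), §4.1 (`G(𝔸) = G_∞ × G(𝔸_f)`), §4.6 (`π ≅ π_∞ ⊗ π_f`).
* [GelbartRogawski1991] S. Gelbart, J. Rogawski, Invent. Math. 105 (1991), §3.2 p. 457.
-/


set_option autoImplicit false

noncomputable section

open NumberField MeasureTheory IsDedekindDomain
open scoped Matrix Kronecker ComplexOrder ENNReal SchwartzMap TensorProduct Classical

namespace Literature.NumberTheory.Automorphic.Liu2021

open _root_.MeasureTheory
open Literature.NumberTheory.Automorphic Literature.NumberTheory.Automorphic.UnitaryGroup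
open Literature.NumberTheory.Automorphic.UnitaryGroup.CotangentForms
open Literature.NumberTheory.Automorphic.IdeleClassGroup
open Literature.NumberTheory.Automorphic.Liu2021.Def411WeilCarriers
open Literature.NumberTheory.Automorphic.Liu2021.Def411WeilCarriersDoubling
open Literature.NumberTheory.GelbartRogawski1991 Literature.NumberTheory.GelbartRogawski1991.UnitaryDualPair
open Literature.NumberTheory.GelbartRogawski1991.UnitaryDualPair.WeilCoinv
open Literature.NumberTheory.Weil1964
open Literature.RepresentationTheory Literature.RepresentationTheory.Liu2021
open Literature.RepresentationTheory.CompactGroups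

/-! ## §2 The finite theta intertwiner `θ̄_{Φ_∞} : ω(μ, ε_a, χ)_f = rhoAtLine … ιV a χ ⟶ P.finRep` -/

section Intertwiner

variable (L : Type) [Field L] [NumberField L] [IsCMField L] (N : ℕ) (H : Matrix (Fin N) (Fin N) L)
  {n' : ℕ} (e₁ : Fin N × Fin 1 ≃ Fin n') (dV : Fin N → L) (hdV : ∀ i, IsCMField.complexConj L (dV i) = dV i)
  (hdV0 : ∀ i, dV i ≠ 0) (g : GL (Fin N) L)
  (hg : ((g : Matrix (Fin N) (Fin N) L).map (cmConjRingHom L))ᵀ * H * (g : Matrix (Fin N) (Fin N) L) = Matrix.diagonal dV)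
  (μ : Literature.NumberTheory.Automorphic.IdeleClassGroup L →ₜ* Circle) (hμ : IsConjugateSymplectic L μ) (a : (↥(maximalRealSubfield L))ˣ)
  (hρ : HasThetaMajorants fun
      (p : ↥(UnitaryGroup.adelic (↥(maximalRealSubfield L)) L (IsCMField.complexConj L) N (Matrix.diagonal dV)) × ↥(UnitaryGroup.adelic (↥(maximalRealSubfield L)) L (IsCMField.complexConj L) 1 (JW (↥(maximalRealSubfield L)) L a))) (Φ : piSchwartzBruhat (↥(maximalRealSubfield L)) (Fin n')) =>
        pairRep (↥(maximalRealSubfield L)) L (IsCMField.complexConj L) N 1 e₁ (Matrix.diagonal dV) (JW (↥(maximalRealSubfield L)) L a)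
          (chiSplittingLine L e₁ dV hdV hdV0 (toHeckeCharacter L μ) (isUnitary_toHeckeCharacter L μ)
            ((isOscillatorChar_toHeckeCharacter_iff μ).mpr hμ) (TW (↥(maximalRealSubfield L)) a)
            (isUnit_det_TW (↥(maximalRealSubfield L)) a) (JW (↥(maximalRealSubfield L)) L a) (JW_eq (↥(maximalRealSubfield L)) L a))
          p Φ)
  [CompactSpace (↥(UnitaryGroup.adelic (↥(maximalRealSubfield L)) L (IsCMField.complexConj L) N (Matrix.diagonal dV)) ⧸ (UnitaryGroup.toAdelic (↥(maximalRealSubfield L)) L (IsCMField.complexConj L) N (Matrix.diagonal dV)).range)] [MeasurableSpace (↥(UnitaryGroup.adelic (↥(maximalRealSubfield L)) L (IsCMField.complexConj L) 1 (JW (↥(maximalRealSubfield L)) L a)) ⧸ (UnitaryGroup.toAdelic (↥(maximalRealSubfield L)) L (IsCMField.complexConj L) 1 (JW (↥(maximalRealSubfield L)) L a)).range)] [BorelSpace (↥(UnitaryGroup.adelic (↥(maximalRealSubfield L)) L (IsCMField.complexConj L) 1 (JW (↥(maximalRealSubfield L)) L a)) ⧸ (UnitaryGroup.toAdelic (↥(maximalRealSubfield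 L)) L (IsCMField.complexConj L) 1 (JW (↥(maximalRealSubfield L)) L a)).range)] (μW : Measure (↥(UnitaryGroup.adelic (↥(maximalRealSubfield L)) L (IsCMField.complexConj L) 1 (JW (↥(maximalRealSubfield L)) L a)) ⧸ (UnitaryGroup.toAdelic (↥(maximalRealSubfield L)) L (IsCMField.complexConj L) 1 (JW (↥(maximalRealSubfield L)) L a)).range)) [IsFiniteMeasure μW] [SMulInvariantMeasure ↥(UnitaryGroup.adelic (↥(maximalRealSubfield L)) L (IsCMField.complexConj L) 1 (JW (↥(maximalRealSubfield L)) L a)) (↥(UnitaryGroup.adelic (↥(maximalRealSubfield L)) L (IsCMField.complexConj L) 1 (JW (↥(maximalRealSubfield L)) L a)) ⧸ (UnitaryGroup.toAdelic (↥(maximalRealSubfield L)) L (IsCMField.complexConj L) 1 (JW (↥(maximalRealSubfield L)) L a)).range) μW]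
  (φ : 𝓢(((Fin N × Fin 1) → NumberField.mixedEmbedding.mixedSpace ↥(maximalRealSubfield L)), ℂ))
  {μA : Measure (adelicGroupData (↥(maximalRealSubfield L)) L (IsCMField.complexConj L) N H).automorphicQuotient}
  [(adelicGroupData (↥(maximalRealSubfield L)) L (IsCMField.complexConj L) N H).IsAutomorphicMeasure μA]
  [CompactSpace (adelicGroupData (↥(maximalRealSubfield L)) L (IsCMField.complexConj L) N H).automorphicQuotient]
  (P : DiscreteAutomorphicRep (adelicGroupData (↥(maximalRealSubfield L)) L (IsCMField.complexConj L) N H) μA)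
  (χ : Chi (↥(maximalRealSubfield L)) L (IsCMField.complexConj L))

set_option maxHeartbeats 1600000 in
/-- **THE FINITE THETA INTERTWINER `θ̄_{Φ_∞}` ([Rallis1984] localisation of the global theta lift, on the finite side).**  For the discrete `P` of
`U(H)`, a fixed archimedean Schwartz factor `Φ_∞` and `χ ∈ Chi`: the `ℂ`-linear map `Φ_f ↦ pr_P [Θ̃_{R_e E(Φ_∞ ⊗ Φ_f)}(charCM χ̃) ∘ ιA]`
(`pr_P` = orthogonal projection onto `P ⊂ L²([U(H)])`, `χ̃ = chiQuot a χ`) kills `ω_f(1,u)Φ_f − χ_W(u)Φ_f` (`toLp_lineThetaLift_tensor_finPairRep_one`), hence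
factors through the `χ_W`-coinvariants `omegaAtLine … a χ` of the finite Weil representation (★ `WeilCoinv.weilCoinvLift`), and the factored map is
`U(H)(𝔸_{L⁺,f})`-EQUIVARIANT from `rhoAtLine … ιV a χ` (canonical finite transport `ιV = finPart ∘ cmAdelicFrameTransport ∘ finAdelicToAdelic`) to
`P.finRep` (`rightRegular_finAdelicToAdelic_toLp_lineThetaLift_tensor` + ★ `orthogonalProjectionOnto_rightRegular`): an intertwiner `θ̄_{Φ_∞}` with
`θ̄_{Φ_∞} (mk Φ_f) = pr_P [Θ̃_{R_e E(Φ_∞ ⊗ Φ_f)}(charCM χ̃) ∘ ιA]`.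
[cite: Liu2021, proof of Prop. 4.13 Case 1 (l. 2136–2137, p. 48); App. D §D.1 Step 3 (l. 5221)] [cite: Rallis1984, Thm. 1.2.2 proof p. 356]
[cite: MoeglinVignerasWaldspurger1987, Chap. 3 IV] -/
theorem exists_intertwiningMap_rhoAtLine_finRep :
    haveI := normal_range_toAdelic_JW L a
    ∃ θ : (rhoAtLine (↥(maximalRealSubfield L)) L (IsCMField.complexConj L) N e₁ (Matrix.diagonal dV) (complexConj_imagUnit L)
          (imagUnit_ne_zero L) (imagUnit_mul_self L) (realDiagonal_isSymm L dV hdV) (isUnit_det_realDiagonal L dV hdV hdV0)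
          (realDiagonal_map L dV hdV).symm
          (fun b => isCompatible_chiSplittingLine L e₁ dV hdV hdV0 (toHeckeCharacter L μ) (isUnitary_toHeckeCharacter L μ)
            ((isOscillatorChar_toHeckeCharacter_iff μ).mpr hμ) (TW (↥(maximalRealSubfield L)) b) (isSymm_TW (↥(maximalRealSubfield L)) b)
            (isUnit_det_TW (↥(maximalRealSubfield L)) b) (JW (↥(maximalRealSubfield L)) L b) (JW_eq (↥(maximalRealSubfield L)) L b))
          ((finPart (↥(maximalRealSubfield L)) L (IsCMField.complexConj L) N (Matrix.diagonal dV)).comp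
            ((cmAdelicFrameTransport L N H dV g hg).comp (finAdelicToAdelic (↥(maximalRealSubfield L)) L (IsCMField.complexConj L) N H)))
          a χ).IntertwiningMap P.finRep,
      ∀ Φf : FinSB (↥(maximalRealSubfield L)) (Fin N × Fin 1),
        ((θ (TwistedCoinv.mk _ _ Φf) : P.space.toSubmodule) : Lp ℂ 2 μA) =
          P.space.toSubmodule.starProjection
            (MemLp.toLp _ (memLp_toQuotFun_lineThetaLift L N H e₁ dV hdV hdV0 g hg μ hμ a hρ μW
              (piSBReindex (↥(maximalRealSubfield L)) e₁ (piSchwartzBruhatEquiv (↥(maximalRealSubfield L)) (Fin N × Fin 1) (φ ⊗ₜ[ℂ] Φf)))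
              (charCM (chiQuot (↥(maximalRealSubfield L)) L (IsCMField.complexConj L) (Algebra.IsQuadraticExtension.finrank_eq_two _ L)
                (IsCMField.complexConj_ne_one (K := L)) a χ)) μA 2)) := by
  haveI := normal_range_toAdelic_JW L a
  -- the class map `Φ_f ↦ [Θ̃_{R_e E(Φ_∞ ⊗ Φ_f)}(charCM χ̃) ∘ ιA]`, linear in `Φ_f`
  let cls : FinSB (↥(maximalRealSubfield L)) (Fin N × Fin 1) →ₗ[ℂ] Lp ℂ 2 μA :=
    { toFun := fun Φf => MemLp.toLp _ (memLp_toQuotFun_lineThetaLift L N H e₁ dV hdV hdV0 g hg μ hμ a hρ μW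
          (piSBReindex (↥(maximalRealSubfield L)) e₁ (piSchwartzBruhatEquiv (↥(maximalRealSubfield L)) (Fin N × Fin 1) (φ ⊗ₜ[ℂ] Φf)))
          (charCM (chiQuot (↥(maximalRealSubfield L)) L (IsCMField.complexConj L) (Algebra.IsQuadraticExtension.finrank_eq_two _ L)
            (IsCMField.complexConj_ne_one (K := L)) a χ)) μA 2)
      map_add' := fun Φf Φf' => toLp_lineThetaLift_tensor_add L N H e₁ dV hdV hdV0 g hg μ hμ a hρ μW _ φ μA Φf Φf'
      map_smul' := fun c Φf => by
        rw [RingHom.id_apply]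
        exact toLp_lineThetaLift_tensor_smul L N H e₁ dV hdV hdV0 g hg μ hμ a hρ μW _ φ μA c Φf }
  -- followed by the orthogonal projection onto `P`
  let T : FinSB (↥(maximalRealSubfield L)) (Fin N × Fin 1) →ₗ[ℂ] P.space.toSubmodule :=
    (P.space.toSubmodule.orthogonalProjectionOnto : Lp ℂ 2 μA →L[ℂ] P.space.toSubmodule).toLinearMap ∘ₗ cls
  have hT : ∀ Φf, T Φf = P.space.toSubmodule.orthogonalProjectionOnto (cls Φf) := fun _ => rfl
  have hcls : ∀ Φf, cls Φf = MemLp.toLp _ (memLp_toQuotFun_lineThetaLift L N H e₁ dV hdV hdV0 g hg μ hμ a hρ μW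
      (piSBReindex (↥(maximalRealSubfield L)) e₁ (piSchwartzBruhatEquiv (↥(maximalRealSubfield L)) (Fin N × Fin 1) (φ ⊗ₜ[ℂ] Φf)))
      (charCM (chiQuot (↥(maximalRealSubfield L)) L (IsCMField.complexConj L) (Algebra.IsQuadraticExtension.finrank_eq_two _ L)
        (IsCMField.complexConj_ne_one (K := L)) a χ)) μA 2) := fun _ => rfl
  -- `χ_W`-covariance: `T` kills the relation module of the coinvariants
  have hcov : ∀ (u : finAdelic (↥(maximalRealSubfield L)) L (IsCMField.complexConj L) 1 (JW (↥(maximalRealSubfield L)) L a))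
      (Φf : FinSB (↥(maximalRealSubfield L)) (Fin N × Fin 1)),
      T (finPairRep (↥(maximalRealSubfield L)) L (IsCMField.complexConj L) N 1 e₁ (Matrix.diagonal dV) (JW (↥(maximalRealSubfield L)) L a)
          (complexConj_imagUnit L) (imagUnit_ne_zero L) (imagUnit_mul_self L) (realDiagonal_isSymm L dV hdV) (isSymm_TW (↥(maximalRealSubfield L)) a)
          (isUnit_det_realDiagonal L dV hdV hdV0) (isUnit_det_TW (↥(maximalRealSubfield L)) a) (realDiagonal_map L dV hdV).symm
          (JW_eq (↥(maximalRealSubfield L)) L a)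
          (isCompatible_chiSplittingLine L e₁ dV hdV hdV0 (toHeckeCharacter L μ) (isUnitary_toHeckeCharacter L μ)
            ((isOscillatorChar_toHeckeCharacter_iff μ).mpr hμ) (TW (↥(maximalRealSubfield L)) a) (isSymm_TW (↥(maximalRealSubfield L)) a)
            (isUnit_det_TW (↥(maximalRealSubfield L)) a) (JW (↥(maximalRealSubfield L)) L a) (JW_eq (↥(maximalRealSubfield L)) L a))
          (1, u) Φf) =
        ((lineChar (↥(maximalRealSubfield L)) L (IsCMField.complexConj L) a χ.1 u : ℂˣ) : ℂ) • T Φf := by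
    intro u Φf
    rw [hT, hT, hcls, hcls, toLp_lineThetaLift_tensor_finPairRep_one L N H e₁ dV hdV hdV0 g hg μ hμ a hρ μW φ μA χ u Φf, map_smul]
  -- `U(H)(𝔸_{L⁺,f})`-equivariance
  have heqv : ∀ (k : finAdelic (↥(maximalRealSubfield L)) L (IsCMField.complexConj L) N H) (Φf : FinSB (↥(maximalRealSubfield L)) (Fin N × Fin 1)),
      T (finPairRep (↥(maximalRealSubfield L)) L (IsCMField.complexConj L) N 1 e₁ (Matrix.diagonal dV) (JW (↥(maximalRealSubfield L)) L a)
          (complexConj_imagUnit L) (imagUnit_ne_zero L) (imagUnit_mul_self L) (realDiagonal_isSymm L dV hdV) (isSymm_TW (↥(maximalRealSubfield L)) a)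
          (isUnit_det_realDiagonal L dV hdV hdV0) (isUnit_det_TW (↥(maximalRealSubfield L)) a) (realDiagonal_map L dV hdV).symm
          (JW_eq (↥(maximalRealSubfield L)) L a)
          (isCompatible_chiSplittingLine L e₁ dV hdV hdV0 (toHeckeCharacter L μ) (isUnitary_toHeckeCharacter L μ)
            ((isOscillatorChar_toHeckeCharacter_iff μ).mpr hμ) (TW (↥(maximalRealSubfield L)) a) (isSymm_TW (↥(maximalRealSubfield L)) a)
            (isUnit_det_TW (↥(maximalRealSubfield L)) a) (JW (↥(maximalRealSubfield L)) L a) (JW_eq (↥(maximalRealSubfield L)) L a))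
          ((finPart (↥(maximalRealSubfield L)) L (IsCMField.complexConj L) N (Matrix.diagonal dV)
            (cmAdelicFrameTransport L N H dV g hg (finAdelicToAdelic (↥(maximalRealSubfield L)) L (IsCMField.complexConj L) N H k))), 1) Φf) =
        P.finRep k (T Φf) := by
    intro k Φf
    rw [hT, hT, hcls, hcls, DiscreteAutomorphicRep.finRep_apply, ← DiscreteAutomorphicRep.orthogonalProjectionOnto_rightRegular,
      rightRegular_finAdelicToAdelic_toLp_lineThetaLift_tensor L N H e₁ dV hdV hdV0 g hg μ hμ a hρ μW _ φ μA k Φf]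
  refine ⟨LinearMap.intertwiningMap_of_isIntertwiningMap _ _
      (weilCoinvLift (↥(maximalRealSubfield L)) L (IsCMField.complexConj L) N 1 e₁ (Matrix.diagonal dV) (JW (↥(maximalRealSubfield L)) L a)
        (complexConj_imagUnit L) (imagUnit_ne_zero L) (imagUnit_mul_self L) (realDiagonal_isSymm L dV hdV) (isSymm_TW (↥(maximalRealSubfield L)) a)
        (isUnit_det_realDiagonal L dV hdV hdV0) (isUnit_det_TW (↥(maximalRealSubfield L)) a) (realDiagonal_map L dV hdV).symm
        (JW_eq (↥(maximalRealSubfield L)) L a) (lineChar (↥(maximalRealSubfield L)) L (IsCMField.complexConj L) a χ.1)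
        (isCompatible_chiSplittingLine L e₁ dV hdV hdV0 (toHeckeCharacter L μ) (isUnitary_toHeckeCharacter L μ)
          ((isOscillatorChar_toHeckeCharacter_iff μ).mpr hμ) (TW (↥(maximalRealSubfield L)) a) (isSymm_TW (↥(maximalRealSubfield L)) a)
          (isUnit_det_TW (↥(maximalRealSubfield L)) a) (JW (↥(maximalRealSubfield L)) L a) (JW_eq (↥(maximalRealSubfield L)) L a))
        T hcov) (fun k x => ?_), fun Φf => ?_⟩
  · -- on generators `mk Φ_f`: `θ̄ (ρ(k) mk Φ_f) = θ̄ (mk (ω_f(ιV k, 1) Φ_f)) = T (ω_f(ιV k, 1) Φ_f)` definitionally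
    obtain ⟨Φf, rfl⟩ := TwistedCoinv.mk_surjective _ _ x
    exact heqv k Φf
  · show ((T Φf : P.space.toSubmodule) : Lp ℂ 2 μA) = _
    rw [hT, hcls, Submodule.coe_orthogonalProjectionOnto_apply]

end Intertwiner

/-! ## §3 The (C♯)hol frame (`N = 3`): `P.HasFinComponent (rhoAtLine … ιV a χ)` for some `χ ∈ Chi` -/

section HolSeam

variable (L : Type) [Field L] [NumberField L] [IsCMField L] (ι : L →+* ℂ) (H : Matrix (Fin 3) (Fin 3) L) (T : GL (Fin 3) ℂ)
  (hT : (T : Matrix (Fin 3) (Fin 3) ℂ)ᴴ * H.map ι * (T : Matrix (Fin 3) (Fin 3) ℂ) = Literature.Geometry.ComplexHyperbolic.BallModel.J)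
  {n' : ℕ} (e₁ : Fin 3 × Fin 1 ≃ Fin n') (dV : Fin 3 → L) (hdV : ∀ i, IsCMField.complexConj L (dV i) = dV i)
  (hdV0 : ∀ i, dV i ≠ 0) (g : GL (Fin 3) L)
  (hg : ((g : Matrix (Fin 3) (Fin 3) L).map (cmConjRingHom L))ᵀ * H * (g : Matrix (Fin 3) (Fin 3) L) = Matrix.diagonal dV)
  (μ : Literature.NumberTheory.Automorphic.IdeleClassGroup L →ₜ* Circle) (hμ : IsConjugateSymplectic L μ) (a : (↥(maximalRealSubfield L))ˣ)

variable
  [CompactSpace (↥(UnitaryGroup.adelic (↥(maximalRealSubfield L)) L (IsCMField.complexConj L) 3 (Matrix.diagonal dV)) ⧸ (UnitaryGroup.toAdelic (↥(maximalRealSubfield L)) L (IsCMField.complexConj L) 3 (Matrix.diagonal dV)).range)]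

omit [CompactSpace (↥(UnitaryGroup.adelic (↥(maximalRealSubfield L)) L (IsCMField.complexConj L) 3 (Matrix.diagonal dV)) ⧸ (UnitaryGroup.toAdelic (↥(maximalRealSubfield L)) L (IsCMField.complexConj L) 3 (Matrix.diagonal dV)).range)] in
/-- `2 ≤ n'` for `e₁ : Fin 3 × Fin 1 ≃ Fin n'` (`n' = 3`; the rank hypothesis of ★ `isIrreducibleOrZero_rhoVAtLine_chiSplittingLine`). [folklore] -/
private theorem two_le_of_equiv_fin_three (e₁ : Fin 3 × Fin 1 ≃ Fin n') : 2 ≤ n' := by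
  have h := Fintype.card_congr e₁
  simp only [Fintype.card_prod, Fintype.card_fin] at h
  omega

set_option maxHeartbeats 1600000 in
/-- **NODE B OF THE (C♯)hol INTERIOR — `P.HasFinComponent (ω(μ, ε_a, χ)_f)` for some `χ ∈ Chi`** ([Liu2021, Prop. 4.13 proof Case 1, «In other words …
`π^∞ ≃ ω(μ, ε_e, χ)`»]), in the frame of (C♯)hol at the CANONICAL transports `ιA = cmAdelicFrameTransport`, `ιV = finPart ∘ ιA ∘ finAdelicToAdelic`:
if the discrete `P` of `U(H)` meets the theta lift from `⟨a⟩` at the `μ`-splitting (seam ★ `MeetsThetaLiftFromLine`) and contains a non-zero holomorphic-cotangent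
coordinate class (the `IsHolCotangentAt` datum, made explicit as in ★ `exists_chi_starProjection_ne_zero_of_holCotForm`), then for the `χ ∈ Chi` and the pure
tensor `Φ_∞ ⊗ Φ_f` of ★ (5)+(1b) the finite theta intertwiner `θ̄_{Φ_∞}` of §2 is NON-ZERO at `mk Φ_f`, and `rhoAtLine … ιV a χ` is irreducible-or-zero (★
`isIrreducibleOrZero_rhoVAtLine_chiSplittingLine_comp_of_surjective`, [Liu2021, Lem. D.1]; `ιV` onto), so `θ̄_{Φ_∞}` is injective
(★ `hasFinComponent_of_isIrreducibleOrZero`). [cite: Liu2021, proof of Prop. 4.13 Case 1 (l. 2136–2137, p. 48); Def. 4.11 (l. 2092–2096); App. D Lemma D.1 (l. 5227)]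
[cite: Rallis1984, Thm. 1.2.2 proof p. 356] [cite: BorelJacquet1979, §4.6] -/
theorem MeetsThetaLiftFromLine.exists_hasFinComponent_rhoAtLine_of_holCotForm
    {μA : Measure (adelicGroupData (↥(maximalRealSubfield L)) L (IsCMField.complexConj L) 3 H).automorphicQuotient}
    [(adelicGroupData (↥(maximalRealSubfield L)) L (IsCMField.complexConj L) 3 H).IsAutomorphicMeasure μA]
    [CompactSpace (adelicGroupData (↥(maximalRealSubfield L)) L (IsCMField.complexConj L) 3 H).automorphicQuotient]
    (P : DiscreteAutomorphicRep (adelicGroupData (↥(maximalRealSubfield L)) L (IsCMField.complexConj L) 3 H) μA)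
    {Φh : (adelicGroupData (↥(maximalRealSubfield L)) L (IsCMField.complexConj L) 3 H).Adelic → (Fin 2 → ℂ)}
    (hΦh : Φh ∈ holCotForms (↥(maximalRealSubfield L)) L (IsCMField.complexConj L) 3 H (cmArchSection L ι H T hT)
      (cmCompactFactor L ι H T hT))
    {j : Fin 2} (hj : MemLp (toQuotFun (adelicGroupData (↥(maximalRealSubfield L)) L (IsCMField.complexConj L) 3 H) fun x => Φh x j) 2 μA)
    (hjmem : hj.toLp _ ∈ P.space.toSubmodule) (hjne : hj.toLp _ ≠ 0)
    (h : MeetsThetaLiftFromLine L 3 H e₁ dV hdV hdV0 P μ hμ a (cmAdelicFrameTransport L 3 H dV g hg)) :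
    ∃ χ : Chi (↥(maximalRealSubfield L)) L (IsCMField.complexConj L),
      P.HasFinComponent
        (rhoAtLine (↥(maximalRealSubfield L)) L (IsCMField.complexConj L) 3 e₁ (Matrix.diagonal dV)
          (complexConj_imagUnit L) (imagUnit_ne_zero L) (imagUnit_mul_self L) (realDiagonal_isSymm L dV hdV)
          (isUnit_det_realDiagonal L dV hdV hdV0) (realDiagonal_map L dV hdV).symm
          (fun a => isCompatible_chiSplittingLine L e₁ dV hdV hdV0 (toHeckeCharacter L μ)
            (isUnitary_toHeckeCharacter L μ) ((isOscillatorChar_toHeckeCharacter_iff μ).mpr hμ)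
            (TW (↥(maximalRealSubfield L)) a) (isSymm_TW (↥(maximalRealSubfield L)) a)
            (isUnit_det_TW (↥(maximalRealSubfield L)) a) (JW (↥(maximalRealSubfield L)) L a)
            (JW_eq (↥(maximalRealSubfield L)) L a))
          ((finPart (↥(maximalRealSubfield L)) L (IsCMField.complexConj L) 3 (Matrix.diagonal dV)).comp
            ((cmAdelicFrameTransport L 3 H dV g hg).comp (finAdelicToAdelic (↥(maximalRealSubfield L)) L (IsCMField.complexConj L) 3 H)))
          a χ) := by
  letI : MeasurableSpace (↥(UnitaryGroup.adelic (↥(maximalRealSubfield L)) L (IsCMField.complexConj L) 1 (JW (↥(maximalRealSubfield L)) L a)) ⧸ (UnitaryGroup.toAdelic (↥(maximalRealSubfield L)) L (IsCMField.complexConj L) 1 (JW (↥(maximalRealSubfield L)) L a)).range) := borel _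
  haveI : BorelSpace (↥(UnitaryGroup.adelic (↥(maximalRealSubfield L)) L (IsCMField.complexConj L) 1 (JW (↥(maximalRealSubfield L)) L a)) ⧸ (UnitaryGroup.toAdelic (↥(maximalRealSubfield L)) L (IsCMField.complexConj L) 1 (JW (↥(maximalRealSubfield L)) L a)).range) := ⟨rfl⟩
  haveI := normal_range_toAdelic_JW L a
  obtain ⟨hρ, μW, hfinm, hinv, Φinf, Φfin, hfin, χ, hθ, hne⟩ :=
    h.exists_chi_starProjection_ne_zero_of_holCotForm_tensor L ι H T hT e₁ dV hdV hdV0 g hg μ hμ a P hΦh hj hjmem hjne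
  haveI : IsFiniteMeasure μW := hfinm
  haveI : SMulInvariantMeasure ↥(UnitaryGroup.adelic (↥(maximalRealSubfield L)) L (IsCMField.complexConj L) 1 (JW (↥(maximalRealSubfield L)) L a)) (↥(UnitaryGroup.adelic (↥(maximalRealSubfield L)) L (IsCMField.complexConj L) 1 (JW (↥(maximalRealSubfield L)) L a)) ⧸ (UnitaryGroup.toAdelic (↥(maximalRealSubfield L)) L (IsCMField.complexConj L) 1 (JW (↥(maximalRealSubfield L)) L a)).range) μW := hinv
  -- the witness `Φ_∞ ⊗ Φ_f` of ★ (1b), read in the Kronecker currency of the finite Weil representation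
  have hΨ : piSBReindex (↥(maximalRealSubfield L)) e₁ (piSchwartzBruhatEquiv (↥(maximalRealSubfield L)) (Fin 3 × Fin 1)
        (schwartzReindexCLM (↥(maximalRealSubfield L)) e₁.symm Φinf ⊗ₜ[ℂ] finSBReindex (↥(maximalRealSubfield L)) e₁.symm ⟨Φfin, hfin⟩)) =
      ⟨fun v => Φinf (piArch (↥(maximalRealSubfield L)) (Fin n') v) * Φfin (piFinite (↥(maximalRealSubfield L)) (Fin n') v),
        tensor_mem_piSchwartzBruhat Φinf hfin⟩ := by
    rw [piSBReindex_tmul, schwartzReindexCLM_schwartzReindexCLM_symm, ← finSBReindex_symm, LinearEquiv.apply_symm_apply]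
    exact Subtype.ext (coe_piSchwartzBruhatEquiv_tmul (↥(maximalRealSubfield L)) (Fin n') Φinf ⟨Φfin, hfin⟩)
  obtain ⟨θ, hθv⟩ := exists_intertwiningMap_rhoAtLine_finRep L 3 H e₁ dV hdV hdV0 g hg μ hμ a hρ μW
    (schwartzReindexCLM (↥(maximalRealSubfield L)) e₁.symm Φinf) P χ
  refine ⟨χ, P.hasFinComponent_of_isIrreducibleOrZero ?_ θ
    (w := TwistedCoinv.mk _ _ (finSBReindex (↥(maximalRealSubfield L)) e₁.symm ⟨Φfin, hfin⟩)) ?_⟩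
  · exact isIrreducibleOrZero_rhoVAtLine_chiSplittingLine_comp_of_surjective L e₁ (two_le_of_equiv_fin_three e₁) dV hdV hdV0
      (toHeckeCharacter L μ) (isUnitary_toHeckeCharacter L μ) ((isOscillatorChar_toHeckeCharacter_iff μ).mpr hμ) a χ _
      (finPart_cmAdelicFrameTransport_finAdelicToAdelic_surjective L 3 H dV g hg)
  · intro h0
    apply hne
    have h1 := hθv (finSBReindex (↥(maximalRealSubfield L)) e₁.symm ⟨Φfin, hfin⟩)
    rw [h0, toLp_lineThetaLift_congr L 3 H e₁ dV hdV hdV0 g hg μ hμ a hρ μW _ μA hΨ] at h1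
    rw [← h1]
    exact ZeroMemClass.coe_zero _

include hg in
/-- **The same at the letter's OWN transports**: for ANY `ιV : U(H)(𝔸_{L⁺,f}) →* U(diag dV)(𝔸_{L⁺,f})` and `ιA : U(H)(𝔸_{L⁺}) →* U(diag dV)(𝔸_{L⁺})` pinned
by the matrix formulas `↑(ιV k) = g_f⁻¹ k g_f` (`hιV`) and `↑(ιA k) = g_𝔸⁻¹ k g_𝔸` (`hιA`) of (C♯)hol ∕ ★ `meetsThetaLiftFromLine_hasFinComponent_rhoAtLine`
(they ARE the canonical ones: §0 + ★ `eq_cmAdelicFrameTransport_of_coe`).  This is the letter with `IsHolCotangentAt` unpacked into a non-zero coordinate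
class and `CompactSpace [U(H)]` assumed (both supplied Summit-side from definiteness and continuity).
[cite: Liu2021, proof of Prop. 4.13 Case 1 (l. 2136–2137, p. 48); Def. 4.11 (l. 2092–2096); App. D §D.1 Step 3 (l. 5221)]
[cite: Rallis1984, Thm. 1.2.2 proof p. 356] [cite: GelbartRogawski1991, §3.2 p. 457] [cite: BorelJacquet1979, §4.6] -/
theorem MeetsThetaLiftFromLine.exists_hasFinComponent_rhoAtLine_of_holCotForm_of_coe
    {μA : Measure (adelicGroupData (↥(maximalRealSubfield L)) L (IsCMField.complexConj L) 3 H).automorphicQuotient}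
    [(adelicGroupData (↥(maximalRealSubfield L)) L (IsCMField.complexConj L) 3 H).IsAutomorphicMeasure μA]
    [CompactSpace (adelicGroupData (↥(maximalRealSubfield L)) L (IsCMField.complexConj L) 3 H).automorphicQuotient]
    (P : DiscreteAutomorphicRep (adelicGroupData (↥(maximalRealSubfield L)) L (IsCMField.complexConj L) 3 H) μA)
    (ιV : finAdelic (↥(maximalRealSubfield L)) L (IsCMField.complexConj L) 3 H →*
      finAdelic (↥(maximalRealSubfield L)) L (IsCMField.complexConj L) 3 (Matrix.diagonal dV))
    (hιV : ∀ k, ((ιV k : finAdelic (↥(maximalRealSubfield L)) L (IsCMField.complexConj L) 3 (Matrix.diagonal dV)) :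
          GL (Fin 3) (FiniteAdeleRing (𝓞 L) L)) =
        (toFinAdeleGL L 3 g)⁻¹ * (k : GL (Fin 3) (FiniteAdeleRing (𝓞 L) L)) * toFinAdeleGL L 3 g)
    (ιA : (adelicGroupData (↥(maximalRealSubfield L)) L (IsCMField.complexConj L) 3 H).Adelic →*
      ↥(UnitaryGroup.adelic (↥(maximalRealSubfield L)) L (IsCMField.complexConj L) 3 (Matrix.diagonal dV)))
    (hιA : ∀ k, ((ιA k : ↥(UnitaryGroup.adelic (↥(maximalRealSubfield L)) L (IsCMField.complexConj L) 3 (Matrix.diagonal dV))) :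
          GL (Fin 3) (AdeleRing (𝓞 L) L)) =
        (toAdeleGL L g)⁻¹ * adelicVal (↥(maximalRealSubfield L)) L (IsCMField.complexConj L) 3 H k * toAdeleGL L g)
    {Φh : (adelicGroupData (↥(maximalRealSubfield L)) L (IsCMField.complexConj L) 3 H).Adelic → (Fin 2 → ℂ)}
    (hΦh : Φh ∈ holCotForms (↥(maximalRealSubfield L)) L (IsCMField.complexConj L) 3 H (cmArchSection L ι H T hT)
      (cmCompactFactor L ι H T hT))
    {j : Fin 2} (hj : MemLp (toQuotFun (adelicGroupData (↥(maximalRealSubfield L)) L (IsCMField.complexConj L) 3 H) fun x => Φh x j) 2 μA)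
    (hjmem : hj.toLp _ ∈ P.space.toSubmodule) (hjne : hj.toLp _ ≠ 0)
    (h : MeetsThetaLiftFromLine L 3 H e₁ dV hdV hdV0 P μ hμ a ιA) :
    ∃ χ : Chi (↥(maximalRealSubfield L)) L (IsCMField.complexConj L),
      P.HasFinComponent
        (rhoAtLine (↥(maximalRealSubfield L)) L (IsCMField.complexConj L) 3 e₁ (Matrix.diagonal dV)
          (complexConj_imagUnit L) (imagUnit_ne_zero L) (imagUnit_mul_self L) (realDiagonal_isSymm L dV hdV)
          (isUnit_det_realDiagonal L dV hdV hdV0) (realDiagonal_map L dV hdV).symm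
          (fun a => isCompatible_chiSplittingLine L e₁ dV hdV hdV0 (toHeckeCharacter L μ)
            (isUnitary_toHeckeCharacter L μ) ((isOscillatorChar_toHeckeCharacter_iff μ).mpr hμ)
            (TW (↥(maximalRealSubfield L)) a) (isSymm_TW (↥(maximalRealSubfield L)) a)
            (isUnit_det_TW (↥(maximalRealSubfield L)) a) (JW (↥(maximalRealSubfield L)) L a)
            (JW_eq (↥(maximalRealSubfield L)) L a)) ιV a χ) := by
  obtain rfl := eq_cmAdelicFrameTransport_of_coe L 3 H dV g hg ιA hιA
  obtain rfl := eq_finPart_cmAdelicFrameTransport_finAdelicToAdelic_of_coe L 3 H dV g hg ιV hιV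
  exact h.exists_hasFinComponent_rhoAtLine_of_holCotForm L ι H T hT e₁ dV hdV hdV0 g hg μ hμ a P hΦh hj hjmem hjne

end HolSeam

end Literature.NumberTheory.Automorphic.Liu2021

end
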